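import Summits.QuantumFields.YangMills.Theorems.BalabanUVNodesPortS1G3CWalkAlg
import Summits.QuantumFields.YangMills.Theorems.BalabanUVNodesPortS1G3CCollect

/-!
# NODE O port PT-A — `stub_G3C` (repaired edition `G3CAtRecordL`), layer (D4c): THE WALKS — terms, localization, the pieces `W(X)` and `EG`, and the algebra
# `Tr[C₀·Rᵐ] = Σ_{walks of length m} t_ω`, `Σ_X W_m(X) = Tr[C₀·Rᵐ]` (given that non-vanishing walks have connected localization), `Σ_X EG = Tr A⁻¹` (row (g1), every φ)

Memo §5c (hand `hand-27930-G3C` g0, v1.5).  A walk of length `m` rooted at `□₀` is `w : Fin m → □ × Dom`; its step matrices are `S_{□,Y}` (✓`g3cStep`, p822521) when `Y ⊄ □̃` and `0`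
otherwise (`g3cStepM`), its term is `t(□₀, w) := Tr[G_{□₀}𝟙_{□₀}·Π_i S(w_i)]` (`g3cWalkTerm`), its localization `X(□₀,w) := □̃₀ ∪ ⋃_i (Y_i ∪ □̃_i)` (`g3cWalkLoc`); `W_m(X)` sums the
terms with localization `X` (`g3cWm`), `W(X) := Σ'_m (−1)ᵐ W_m(X)` (`g3cW`), and `EG := collect X_full W (Tr A⁻¹)` (`g3cEG`, ✓`G3CInv.collect` p822860) — so row (g1) of `G3CPiecesAt` holds
for EVERY `φ` (`sum_g3cEG`), with no germ membership.  Cell `ym-nodeO-ideate`; definition kind, `--supports stmt-QuantumFields-27930 --as helper`; count-neutral.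

WHAT THIS FILE PROVES (sorry-free): generic `G3CInv.sum_fin_succ_cons`, ★ `G3CInv.pow_sum_eq_sum_listProd` (non-commutative multinomial expansion `(Σ_s f s)ᵐ = Σ_{w : Fin m → σ} Π_i f(w_i)`);
`g3cR_eq_sum_stepM` (`R = Σ_{(□,Y)} S^M_{□,Y}`), ★ `trace_C0_mul_R_pow` (`Tr[C₀Rᵐ] = Σ_{□₀} Σ_w t(□₀,w)`), ★ `sum_g3cWm_eq` (`Σ_X W_m(X) = Σ_{□₀,w} t` given connected localization of
non-vanishing walks), `norm_g3cWalkTerm_le` (`|t| ≤ N_□(1∕γ₀)Π‖S^M(w_i)‖`), `norm_g3cStepM_le` , ★ `sum_g3cEG` ((g1) for every φ), `g3cEG_eq_g3cW_of_sum_eq`, `g3cEG_of_ne_full`.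

HONEST FRAMING.  Definitions and finite algebra under the HYPOTHESIS `P0CarrierClauses …` (inhabited nowhere); nothing of Bałaban asserted, ported or discharged; `stub_G3C` NOT closed;
27930 OPEN; NODE O 0∕1; COUNT 8∕28 · K 1∕4 UNMOVED; finite `𝕋⁴_{L^K}` at fixed ε — NOT continuum ∕ OS ∕ Clay; **the Yang–Mills mass gap is NOT proved by any of this.**
No `sorry`, no `instance`, no `notation`; standard axioms.  [B9] = [Balaban1985BackgroundPropagators], [16] = [Balaban1985UV3].
-/

noncomputable section

open scoped BigOperators Matrix.Norms.L2Operator Topology Matrix Classical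
open Filter Finset

namespace Summit.QuantumFields.YangMills.Theorems.BalabanUVNodesPortS1

open Summit.QuantumFields.YangMills.Theorems.K0RecordFormatNames
open Literature.MathematicalPhysics.QuantumFieldTheory.Balaban1983to89
open Literature.MathematicalPhysics.QuantumFieldTheory.Balaban1983to89.Node00
open Literature.MathematicalPhysics.QuantumFieldTheory.Balaban1983to89.T4Continuum (T4Family)
open Literature.MathematicalPhysics.QuantumFieldTheory.Balaban1983to89.TreeLengthTorus (TPt IsTDom)

/-! ## Generic: the non-commutative multinomial expansion -/

namespace G3CInv

variable {σ : Type*} [Fintype σ]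

/-- Splitting a sum over `Fin (m+1) → σ` by the first letter. [folklore] -/
theorem sum_fin_succ_cons {M : Type*} [AddCommMonoid M] (m : ℕ) (g : (Fin (m + 1) → σ) → M) :
    ∑ w : Fin (m + 1) → σ, g w = ∑ s : σ, ∑ w : Fin m → σ, g (Fin.cons s w) := by
  rw [← Fintype.sum_prod_type']
  exact Fintype.sum_equiv (Fin.consEquiv (fun _ => σ)).symm _ _ (fun w => by
    show g w = g (Fin.cons (w 0) (Fin.tail w)); rw [Fin.cons_self_tail])

/-- ★ **`(Σ_s f s)ᵐ = Σ_{w : Fin m → σ} f(w₀)·f(w₁)⋯f(w_{m−1})`** in a matrix ring (ordered products). [cite: Balaban1985BackgroundPropagators, (3.90) p.409 (random walk expansion)] -/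
theorem pow_sum_eq_sum_listProd {ι : Type*} [Fintype ι] [DecidableEq ι] (m : ℕ) (f : σ → Matrix ι ι ℂ) :
    (∑ s, f s) ^ m = ∑ w : Fin m → σ, (List.ofFn (fun i => f (w i))).prod := by
  induction m with
  | zero => simp
  | succ m ih =>
      rw [pow_succ', ih, Finset.sum_mul_sum, sum_fin_succ_cons m (fun w : Fin (m + 1) → σ => (List.ofFn (fun i => f (w i))).prod)]
      refine Finset.sum_congr rfl fun s _ => Finset.sum_congr rfl fun w _ => ?_
      rw [List.ofFn_succ, List.prod_cons]
      simp only [Fin.cons_zero, Fin.cons_succ]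

end G3CInv

/-! ## The walk objects -/

section Defs

variable (F : T4Family)

/-- **Admissible step matrix** `S^M_{□,Y} := S_{□,Y}` if `Y ⊄ □̃`, `:= 0` otherwise (the summands of `R`, ✓`g3cR_eq_sum_step`). [cite: Balaban1985BackgroundPropagators, (3.88) p.409] -/
def g3cStepM (Mc k K : ℕ) (TYK : (recordDomSys F Mc k K).Dom → Sect2.CPair (F.P K) (MatA 2) → FluctIdx F k K → FluctIdx F k K → ℂ)
    (x : ℝ) (φ : Sect2.CPair (F.P K) (MatA 2)) (s : TPt (F.P K).d (Sect2.domCount (F.P K) Mc (k + 1)) × (recordDomSys F Mc k K).Dom) :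
    Matrix (NonB0Idx F k K) (NonB0Idx F k K) ℂ :=
  if (s.2.1 : Finset _) ⊆ (g3cBlk F Mc k K s.1).1 then 0 else g3cStep F Mc k K TYK s.1 s.2 x φ

/-- **The walk term** `t(□₀, w) := Tr[G_{□₀}·𝟙_{□₀}·S^M(w₀)⋯S^M(w_{m−1})]`. [cite: Balaban1985BackgroundPropagators, (3.90) p.409; Balaban1985UV3, (25) p.262] -/
def g3cWalkTerm (Mc k K : ℕ) (TYK : (recordDomSys F Mc k K).Dom → Sect2.CPair (F.P K) (MatA 2) → FluctIdx F k K → FluctIdx F k K → ℂ)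
    (x : ℝ) (φ : Sect2.CPair (F.P K) (MatA 2)) (q₀ : TPt (F.P K).d (Sect2.domCount (F.P K) Mc (k + 1))) {m : ℕ}
    (w : Fin m → TPt (F.P K).d (Sect2.domCount (F.P K) Mc (k + 1)) × (recordDomSys F Mc k K).Dom) : ℂ :=
  (g3cLocInv F Mc k K TYK (g3cBlk F Mc k K q₀) x φ * g3cInd F Mc k K q₀ * (List.ofFn fun i => g3cStepM F Mc k K TYK x φ (w i)).prod).trace

/-- **The localization of a walk** `X(□₀, w) := □̃₀ ∪ ⋃_i (Y_i ∪ □̃_i)` (a cube family; a domain whenever the term is non-zero — layer (D4d)). [cite: Balaban1987RG1, (1.7) p.261; Balaban1985UV3, p.262] -/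
def g3cWalkLoc (Mc k K : ℕ) (q₀ : TPt (F.P K).d (Sect2.domCount (F.P K) Mc (k + 1))) {m : ℕ}
    (w : Fin m → TPt (F.P K).d (Sect2.domCount (F.P K) Mc (k + 1)) × (recordDomSys F Mc k K).Dom) :
    Finset (TPt (F.P K).d (Sect2.domCount (F.P K) Mc (k + 1))) :=
  (g3cBlk F Mc k K q₀).1 ∪ Finset.univ.biUnion fun i : Fin m => ((w i).2.1 : Finset _) ∪ (g3cBlk F Mc k K (w i).1).1

/-- **`W_m(X)`** — the sum of the length-`m` walk terms with localization `X`. [cite: Balaban1987RG1, (1.7) p.261; Balaban1985BackgroundPropagators, (3.90) p.409] -/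
def g3cWm (Mc k K : ℕ) (TYK : (recordDomSys F Mc k K).Dom → Sect2.CPair (F.P K) (MatA 2) → FluctIdx F k K → FluctIdx F k K → ℂ)
    (x : ℝ) (φ : Sect2.CPair (F.P K) (MatA 2)) (m : ℕ) (X : (recordDomSys F Mc k K).Dom) : ℂ :=
  ∑ q₀ : TPt (F.P K).d (Sect2.domCount (F.P K) Mc (k + 1)),
    ∑ w : Fin m → TPt (F.P K).d (Sect2.domCount (F.P K) Mc (k + 1)) × (recordDomSys F Mc k K).Dom,
      if g3cWalkLoc F Mc k K q₀ w = X.1 then g3cWalkTerm F Mc k K TYK x φ q₀ w else 0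

/-- **`W(X) := Σ'_m (−1)ᵐ W_m(X)`** — the walk piece localized in `X`. [cite: Balaban1985BackgroundPropagators, (3.90) p.409, (3.96) p.411] -/
def g3cW (Mc k K : ℕ) (TYK : (recordDomSys F Mc k K).Dom → Sect2.CPair (F.P K) (MatA 2) → FluctIdx F k K → FluctIdx F k K → ℂ)
    (x : ℝ) (φ : Sect2.CPair (F.P K) (MatA 2)) (X : (recordDomSys F Mc k K).Dom) : ℂ :=
  ∑' m : ℕ, (-1) ^ m * g3cWm F Mc k K TYK x φ m X

/-- **`EG`** — the pieces of the resolvent trace: the walk pieces, COLLECTED at `X_full` onto `Tr (x·1 + [TC]_{nonB₀})⁻¹` (memo §5c: row (g1) by bookkeeping). [cite: Balaban1985UV3, (23)–(25) p.262] -/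
def g3cEG (Mc k K : ℕ) (TCK : Sect2.CPair (F.P K) (MatA 2) → FluctIdx F k K → FluctIdx F k K → ℂ)
    (TYK : (recordDomSys F Mc k K).Dom → Sect2.CPair (F.P K) (MatA 2) → FluctIdx F k K → FluctIdx F k K → ℂ)
    (x : ℝ) (X : (recordDomSys F Mc k K).Dom) (φ : Sect2.CPair (F.P K) (MatA 2)) : ℂ :=
  G3CInv.collect (g3cFull F Mc k K) (fun X' => g3cW F Mc k K TYK x φ X')
    (((x : ℂ) • (1 : Matrix (NonB0Idx F k K) (NonB0Idx F k K) ℂ) + nonB0Block F k K (TCK φ))⁻¹).trace X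

end Defs

/-! ## Algebra at the record -/

section Record

variable {F : T4Family}
variable {a₀ δ₀ c₀ γ₀ γ₁ δ₁ : ℝ} {Mc : ℕ} {α₀ α₁ ε₂₉ : ℝ} {k : ℕ}
variable {TC : (n : ℕ) → Sect2.CPair (F.P (recordK₀ F Mc k + n)) (MatA 2) → FluctIdx F k (recordK₀ F Mc k + n) → FluctIdx F k (recordK₀ F Mc k + n) → ℂ}
variable {TY : (n : ℕ) → (recordDomSys F Mc k (recordK₀ F Mc k + n)).Dom → Sect2.CPair (F.P (recordK₀ F Mc k + n)) (MatA 2) →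
  FluctIdx F k (recordK₀ F Mc k + n) → FluctIdx F k (recordK₀ F Mc k + n) → ℂ}
variable {TZY : Finset (Fin 4 → ℤ) → IntBondCfg → ((Fin 4 → ℤ) × Fin 4) × Fin 3 → ((Fin 4 → ℤ) × Fin 4) × Fin 3 → ℂ}
variable {AdM : (n : ℕ) → (Site (F.P (recordK₀ F Mc k + n)) 0 → (MatA 2)ˣ) →
  Matrix (FluctIdx F k (recordK₀ F Mc k + n)) (FluctIdx F k (recordK₀ F Mc k + n)) ℂ}
variable {AdZ : ((Fin 4 → ℤ) → (MatA 2)ˣ) → (Fin 4 → ℤ) × Fin 4 → Matrix (Fin 3) (Fin 3) ℂ}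

/-- **`R = Σ_{(□,Y)} S^M_{□,Y}`** (✓`g3cR_eq_sum_step` over the product index). [cite: Balaban1985BackgroundPropagators, (3.88) p.409] -/
theorem g3cR_eq_sum_stepM (hP : P0CarrierClauses F a₀ δ₀ c₀ γ₀ γ₁ Mc α₀ α₁ ε₂₉ k TC TY TZY AdM AdZ) (n : ℕ) (x : ℝ)
    (φ : Sect2.CPair (F.P (recordK₀ F Mc k + n)) (MatA 2)) :
    g3cR F Mc k (recordK₀ F Mc k + n) (TC n) (TY n) x φ =
      ∑ s : TPt (F.P (recordK₀ F Mc k + n)).d (Sect2.domCount (F.P (recordK₀ F Mc k + n)) Mc (k + 1)) × (recordDomSys F Mc k (recordK₀ F Mc k + n)).Dom,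
        g3cStepM F Mc k (recordK₀ F Mc k + n) (TY n) x φ s := by
  rw [g3cR_eq_sum_step hP n x φ, Fintype.sum_prod_type]
  refine Finset.sum_congr rfl fun q _ => ?_
  rw [Finset.sum_filter]
  refine Finset.sum_congr rfl fun Y _ => ?_
  rw [g3cStepM]
  split_ifs <;> rfl

/-- ★ **`Tr[C₀·Rᵐ] = Σ_{□₀} Σ_{w : Fin m → □ × Dom} t(□₀, w)`.** [cite: Balaban1985BackgroundPropagators, (3.90) p.409; Balaban1985UV3, (25) p.262] -/
theorem trace_C0_mul_R_pow (hP : P0CarrierClauses F a₀ δ₀ c₀ γ₀ γ₁ Mc α₀ α₁ ε₂₉ k TC TY TZY AdM AdZ) (n : ℕ) (x : ℝ)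
    (φ : Sect2.CPair (F.P (recordK₀ F Mc k + n)) (MatA 2)) (m : ℕ) :
    (g3cC0 F Mc k (recordK₀ F Mc k + n) (TY n) x φ * g3cR F Mc k (recordK₀ F Mc k + n) (TC n) (TY n) x φ ^ m).trace =
      ∑ q₀ : TPt (F.P (recordK₀ F Mc k + n)).d (Sect2.domCount (F.P (recordK₀ F Mc k + n)) Mc (k + 1)),
        ∑ w : Fin m → TPt (F.P (recordK₀ F Mc k + n)).d (Sect2.domCount (F.P (recordK₀ F Mc k + n)) Mc (k + 1)) × (recordDomSys F Mc k (recordK₀ F Mc k + n)).Dom,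
          g3cWalkTerm F Mc k (recordK₀ F Mc k + n) (TY n) x φ q₀ w := by
  rw [g3cR_eq_sum_stepM hP n x φ, G3CInv.pow_sum_eq_sum_listProd, g3cC0, Finset.sum_mul, Matrix.trace_sum]
  refine Finset.sum_congr rfl fun q₀ _ => ?_
  rw [Finset.mul_sum, Matrix.trace_sum]
  rfl

/-- ★ **`Σ_X W_m(X) = Σ_{□₀,w} t(□₀,w)`**, given that every NON-VANISHING walk has a connected localization (layer (D4d) supplies this from the support rule). [cite: Balaban1987RG1, (1.7) p.261] -/
theorem sum_g3cWm_eq {K : ℕ} (Mc k : ℕ) (TYK : (recordDomSys F Mc k K).Dom → Sect2.CPair (F.P K) (MatA 2) → FluctIdx F k K → FluctIdx F k K → ℂ) (x : ℝ)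
    (φ : Sect2.CPair (F.P K) (MatA 2)) (m : ℕ)
    (hloc : ∀ (q₀ : TPt (F.P K).d (Sect2.domCount (F.P K) Mc (k + 1))) (w : Fin m → TPt (F.P K).d (Sect2.domCount (F.P K) Mc (k + 1)) × (recordDomSys F Mc k K).Dom),
      g3cWalkTerm F Mc k K TYK x φ q₀ w ≠ 0 → IsTDom (g3cWalkLoc F Mc k K q₀ w)) :
    ∑ X : (recordDomSys F Mc k K).Dom, g3cWm F Mc k K TYK x φ m X =
      ∑ q₀ : TPt (F.P K).d (Sect2.domCount (F.P K) Mc (k + 1)), ∑ w : Fin m → TPt (F.P K).d (Sect2.domCount (F.P K) Mc (k + 1)) × (recordDomSys F Mc k K).Dom,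
        g3cWalkTerm F Mc k K TYK x φ q₀ w := by
  simp only [g3cWm]
  rw [Finset.sum_comm]
  refine Finset.sum_congr rfl fun q₀ _ => ?_
  rw [Finset.sum_comm]
  refine Finset.sum_congr rfl fun w _ => ?_
  by_cases ht : g3cWalkTerm F Mc k K TYK x φ q₀ w = 0
  · rw [ht]; simp
  · have hD := hloc q₀ w ht
    set X₀ : (recordDomSys F Mc k K).Dom := ⟨g3cWalkLoc F Mc k K q₀ w, hD⟩ with hX₀
    have key : ∀ X : (recordDomSys F Mc k K).Dom, (g3cWalkLoc F Mc k K q₀ w = (X.1 : Finset _)) ↔ X = X₀ := fun X =>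
      ⟨fun h => Subtype.ext (by rw [hX₀]; exact h.symm), fun h => by rw [h, hX₀]⟩
    simp only [key, Finset.sum_ite_eq', Finset.mem_univ, if_true]

/-- `‖S^M_{□,Y}‖ ≤ ‖S_{□,Y}‖` and `‖S^M‖ ≤` any bound of `‖S‖` that is `≥ 0`. [folklore] -/
theorem norm_g3cStepM_le {K : ℕ} (Mc k : ℕ) (TYK : (recordDomSys F Mc k K).Dom → Sect2.CPair (F.P K) (MatA 2) → FluctIdx F k K → FluctIdx F k K → ℂ) (x : ℝ)
    (φ : Sect2.CPair (F.P K) (MatA 2)) (s : TPt (F.P K).d (Sect2.domCount (F.P K) Mc (k + 1)) × (recordDomSys F Mc k K).Dom) {b : ℝ} (hb : 0 ≤ b)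
    (h : ¬ ((s.2.1 : Finset _) ⊆ (g3cBlk F Mc k K s.1).1) → ‖g3cStep F Mc k K TYK s.1 s.2 x φ‖ ≤ b) :
    ‖g3cStepM F Mc k K TYK x φ s‖ ≤ b := by
  rw [g3cStepM]
  split_ifs with hs
  · rw [norm_zero]; exact hb
  · exact h hs

/-- **The walk-term majorant at the record**: `|t(□₀,w)| ≤ N_□·(1∕γ₀)·Π_i ‖S^M(w_i)‖` (`x ≥ 0`, `φ ∈ S_{□̃₀}`). [cite: Balaban1985UV3, (25) p.262; Balaban1985BackgroundPropagators, (3.96) p.411] -/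
theorem norm_g3cWalkTerm_le (hP : P0CarrierClauses F a₀ δ₀ c₀ γ₀ γ₁ Mc α₀ α₁ ε₂₉ k TC TY TZY AdM AdZ) (hMc : McGuard F Mc) (hγ₀ : 0 < γ₀) (n : ℕ)
    (q₀ : TPt (F.P (recordK₀ F Mc k + n)).d (Sect2.domCount (F.P (recordK₀ F Mc k + n)) Mc (k + 1))) {φ : Sect2.CPair (F.P (recordK₀ F Mc k + n)) (MatA 2)}
    (hφ : encodeCfg F (recordK₀ F Mc k + n) φ ∈ recordUc F Mc k α₀ α₁ (recordK₀ F Mc k + n) (g3cBlk F Mc k (recordK₀ F Mc k + n) q₀)) {x : ℝ} (hx : 0 ≤ x) {m : ℕ}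
    (w : Fin m → TPt (F.P (recordK₀ F Mc k + n)).d (Sect2.domCount (F.P (recordK₀ F Mc k + n)) Mc (k + 1)) × (recordDomSys F Mc k (recordK₀ F Mc k + n)).Dom) :
    ‖g3cWalkTerm F Mc k (recordK₀ F Mc k + n) (TY n) x φ q₀ w‖ ≤
      (3 * (F.P (recordK₀ F Mc k + n)).d * (F.L * Mc) ^ (F.P (recordK₀ F Mc k + n)).d : ℕ) * (1 / γ₀) *
        ∏ i : Fin m, ‖g3cStepM F Mc k (recordK₀ F Mc k + n) (TY n) x φ (w i)‖ := by
  have h := norm_trace_root_mul_prod_le hP hMc hγ₀ n q₀ hφ hx (List.ofFn fun i => g3cStepM F Mc k (recordK₀ F Mc k + n) (TY n) x φ (w i))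
  rw [List.map_ofFn, List.prod_ofFn] at h
  exact h

/-- ★ **Row (g1) for EVERY `φ`**: `Σ_X EG(x, X, φ) = Tr (x·1 + [TC φ]_{nonB₀})⁻¹` (the collector). [cite: Balaban1985UV3, (23)–(25) p.262] -/
theorem sum_g3cEG {K : ℕ} (Mc k : ℕ) (TCK : Sect2.CPair (F.P K) (MatA 2) → FluctIdx F k K → FluctIdx F k K → ℂ)
    (TYK : (recordDomSys F Mc k K).Dom → Sect2.CPair (F.P K) (MatA 2) → FluctIdx F k K → FluctIdx F k K → ℂ) (x : ℝ) (φ : Sect2.CPair (F.P K) (MatA 2)) :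
    ∑ X : (recordDomSys F Mc k K).Dom, g3cEG F Mc k K TCK TYK x X φ =
      (((x : ℂ) • (1 : Matrix (NonB0Idx F k K) (NonB0Idx F k K) ℂ) + nonB0Block F k K (TCK φ))⁻¹).trace :=
  G3CInv.sum_collect _ _ _

/-- Off `X_full`, `EG` is the walk piece. [folklore] -/
theorem g3cEG_of_ne_full {K : ℕ} (Mc k : ℕ) (TCK : Sect2.CPair (F.P K) (MatA 2) → FluctIdx F k K → FluctIdx F k K → ℂ)
    (TYK : (recordDomSys F Mc k K).Dom → Sect2.CPair (F.P K) (MatA 2) → FluctIdx F k K → FluctIdx F k K → ℂ) (x : ℝ) (φ : Sect2.CPair (F.P K) (MatA 2))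
    {X : (recordDomSys F Mc k K).Dom} (hX : X ≠ g3cFull F Mc k K) :
    g3cEG F Mc k K TCK TYK x X φ = g3cW F Mc k K TYK x φ X :=
  G3CInv.collect_of_ne hX _ _

/-- **Where the full expansion is valid, `EG` IS the walk piece everywhere** (incl. `X_full`). [cite: Balaban1985BackgroundPropagators, (3.96) p.411] -/
theorem g3cEG_eq_g3cW_of_sum_eq {K : ℕ} (Mc k : ℕ) (TCK : Sect2.CPair (F.P K) (MatA 2) → FluctIdx F k K → FluctIdx F k K → ℂ)
    (TYK : (recordDomSys F Mc k K).Dom → Sect2.CPair (F.P K) (MatA 2) → FluctIdx F k K → FluctIdx F k K → ℂ) (x : ℝ) (φ : Sect2.CPair (F.P K) (MatA 2))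
    (h : ∑ X : (recordDomSys F Mc k K).Dom, g3cW F Mc k K TYK x φ X =
      (((x : ℂ) • (1 : Matrix (NonB0Idx F k K) (NonB0Idx F k K) ℂ) + nonB0Block F k K (TCK φ))⁻¹).trace)
    (X : (recordDomSys F Mc k K).Dom) :
    g3cEG F Mc k K TCK TYK x X φ = g3cW F Mc k K TYK x φ X :=
  G3CInv.collect_eq_self_of_sum_eq h X

end Record

end Summit.QuantumFields.YangMills.Theorems.BalabanUVNodesPortS1

end
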